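import Literature.AlgebraicGeometry.HodgeTheory.BettiUniverseAxioms
import HarnessLib

/-!
# Δ2 BRIDGE — S4 CORE: functoriality of complexified Betti pull-back along the composite `P_Γ ↪ X_{K,ℂ} → A_{K,ℂ} → A_{μ,ℂ}`,
# and the rational factor of `φ ∈ Hom_E(A_K, A_μ)_ℚ = ℚ ⊗_ℤ Hom` moved onto the eigenvector

Cell pub-hodgecm2 (COR-CM), Δ2 BRIDGE (COORDINATOR «Δ2 RESTRUCTURE FOR SPEED», 2026-08-23), seat d2bridge-prove-4 = sublemma **S4** of the
CM-side contract `hcm` (`CorCM/D2Bridge/HcmPieces.lean`, fields `qOf ∕ f_of ∕ geom_eq` of `HcmPieces`, v2 = ℚ-indexed).  THEOREMS ONLY, over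
REAL Betti objects of the tree (`Motives.bettiCohomology`, `BettiUniverse.pull`, `pull_comp`); hole-free (imports `HodgeTheory/BettiUniverseAxioms`
only); nothing landed is edited or restated; no `def`, no named fact.

WHAT S4 SAYS ([Liu2021] proof of Thm. 4.18, l. 2247–2253, read at ONE level `K` and ONE `φ`).  The class the `hcm` binder restricts to `P_Γ` is,
after S2 (`P_eq`: the record's pull-back is Betti pull-back along the REAL `φ`) and S3 (`tower_eq`: Lem. 2.4 (1) + tower bookkeeping),
`resX (albK (phiStar φ α))` = «restrict to `P_Γ`» ∘ «`(α_K)^*_ℂ`» ∘ «`φ^*_ℂ`» applied to the eigenvector `α`.  With `resX`, `albK` the complexified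
pull-backs along `incl : P_Γ ⟶ X_{K,ℂ}` and `alb : X_{K,ℂ} ⟶ A_{K,ℂ}`, and `φ = q ⊗ f` (`f` ONE morphism, `q ∈ ℚ` — every element of
`ℚ ⊗_ℤ Hom` has this form, `exists_eq_rat_tmul`), `phiStar (q ⊗ f) = q • (f_ℂ)^*_ℂ`, the class is
`incl^* (alb^* (q • f_ℂ^* α)) = (incl ≫ alb ≫ f_ℂ)^*_ℂ (q • α)` (`geom_eq_core`: `pull_comp` twice + the scalar through the `ℂ`-linear maps)
= `geomClass Γ d_q (incl ≫ alb ≫ f_ℂ)` for the record `d_q` = Liu's CM datum with eigenvector `q • α` — the S4 law `geom_eq` of `HcmPieces` with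
`qOf φ := q`, `f_of φ := incl ≫ alb ≫ f_ℂ` (`exists_qOf_fOf`: the two choice functions, packaged).  The pin instance (after the L38 hole closes)
is these theorems at `P := P_Γ`, `incl ∕ alb` := S3's maps, `bc f := f ⊗_{E,ι₁} ℂ` := S2's, `α := M.α` transported := S1's.
HC_CM is NOT proved; «Δ2 BRIDGE CLOSED» is NOT claimed; no pointer ∕ count ∕ hM token.

## References
* [Liu2021] Y. Liu, *Fourier–Jacobi cycles and arithmetic relative trace formula*, Camb. J. Math. 9 (2021) = arXiv:2102.11518 — proof of
  Thm. 4.18 (FJcycle.tex l. 2247–2253: the map (4.2) `f ⊗ z ↦ z · f^*α`), Lem. 2.4 (1) and its proof (l. 1210–1228), Def. 2.3, (4.1).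
* [HatcherAT2002] A. Hatcher, *Algebraic Topology*, CUP 2002, §3.1 p. 198 (functoriality of `H^*`).
-/

set_option autoImplicit false

noncomputable section

open scoped TensorProduct
open CategoryTheory
open Literature.AlgebraicGeometry.Motives (SchemeOver bettiCohomology)
open Literature.AlgebraicGeometry.HodgeTheory.BettiUniverse (pull pull_comp)

namespace Summit.HodgeConjecture.CorCM.D2Bridge

/-! ## §1 Functoriality of the complexified pull-back `(f^*) ⊗ ℂ` -/

section Functoriality

variable {P X B A : SchemeOver ℂ}

/-- `((f ≫ g)^*)_ℂ c = (f^*)_ℂ ((g^*)_ℂ c)` on complexified classes `ℂ ⊗_ℚ Hᵏ(−(ℂ); ℚ)`. [cite: HatcherAT2002, §3.1 p. 198] -/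
theorem baseChange_pull_comp_apply (f : P ⟶ X) (g : X ⟶ B) (k : ℕ) (c : ℂ ⊗[ℚ] bettiCohomology B k) :
    (pull (f ≫ g) k).baseChange ℂ c = (pull f k).baseChange ℂ ((pull g k).baseChange ℂ c) := by
  rw [pull_comp, LinearMap.baseChange_comp, LinearMap.comp_apply]

/-- The composite of THREE complexified pull-backs is the complexified pull-back along the composite — the shape of S4:
`incl^*_ℂ (alb^*_ℂ (f^*_ℂ c)) = (incl ≫ alb ≫ f)^*_ℂ c`. [cite: HatcherAT2002, §3.1 p. 198] -/
theorem baseChange_pull_comp₃_apply (i : P ⟶ X) (a : X ⟶ B) (f : B ⟶ A) (k : ℕ) (c : ℂ ⊗[ℚ] bettiCohomology A k) :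
    (pull i k).baseChange ℂ ((pull a k).baseChange ℂ ((pull f k).baseChange ℂ c)) =
      (pull (i ≫ a ≫ f) k).baseChange ℂ c := by
  rw [baseChange_pull_comp_apply, baseChange_pull_comp_apply]

/-- A rational factor passes through a complexified pull-back: `q • (g^*)_ℂ c = (g^*)_ℂ (q • c)`. [folklore] -/
theorem rat_smul_baseChange_pull (g : P ⟶ A) (k : ℕ) (q : ℚ) (c : ℂ ⊗[ℚ] bettiCohomology A k) :
    q • (pull g k).baseChange ℂ c = (pull g k).baseChange ℂ (q • c) :=
  (LinearMap.map_smul_of_tower _ q c).symm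

/-- **S4 CORE IDENTITY, one-step form.**  For `j : P ⟶ B` (at the pin: the composite `P_Γ ↪ X_{K,ℂ} → A_{K,ℂ}`, i.e. the pointed
Albanese map of `X_K` restricted to the identity component) and `g : B ⟶ A` (`f_ℂ = f ⊗_{E,ι₁} ℂ` for ONE morphism `f : A_K → A_μ`), and a
rational factor `q` (the factor of `φ = q ⊗ f ∈ ℚ ⊗_ℤ Hom_E(A_K, A_μ)`): `j^*_ℂ (q • g^*_ℂ α) = (j ≫ g)^*_ℂ (q • α)` — i.e.
`geomClass Γ d_q (j ≫ g)` for the record `d_q` whose eigenvector is `q • α`. [cite: Liu2021, proof of Thm. 4.18 (l. 2247–2253); Lem. 2.4 (1)] -/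
theorem geom_eq_core₂ (j : P ⟶ B) (g : B ⟶ A) (q : ℚ) (α : ℂ ⊗[ℚ] bettiCohomology A 1) :
    (pull j 1).baseChange ℂ (q • (pull g 1).baseChange ℂ α) = (pull (j ≫ g) 1).baseChange ℂ (q • α) := by
  rw [rat_smul_baseChange_pull, baseChange_pull_comp_apply]

/-- **S4 CORE IDENTITY.**  For the composite `P ⟶ X ⟶ B ⟶ A` (at the pin: `incl : P_Γ ↪ X_{K,ℂ}`, the pointed Albanese map
`alb = (α_K)_{x,ℂ}`, and `g = f_ℂ = f ⊗_{E,ι₁} ℂ` for ONE morphism `f : A_K → A_μ`) and a rational factor `q` (the factor of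
`φ = q ⊗ f ∈ ℚ ⊗_ℤ Hom_E(A_K, A_μ)`): `incl^*_ℂ (alb^*_ℂ (q • f_ℂ^* α)) = (incl ≫ alb ≫ f_ℂ)^*_ℂ (q • α)` — i.e.
`geomClass Γ d_q (incl ≫ alb ≫ f_ℂ)` for the record `d_q` whose eigenvector is `q • α`. [cite: Liu2021, proof of Thm. 4.18 (l. 2247–2253); Lem. 2.4 (1)] -/
theorem geom_eq_core (incl : P ⟶ X) (alb : X ⟶ B) (g : B ⟶ A) (q : ℚ) (α : ℂ ⊗[ℚ] bettiCohomology A 1) :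
    (pull incl 1).baseChange ℂ ((pull alb 1).baseChange ℂ (q • (pull g 1).baseChange ℂ α)) =
      (pull (incl ≫ alb ≫ g) 1).baseChange ℂ (q • α) := by
  rw [rat_smul_baseChange_pull, baseChange_pull_comp₃_apply]

end Functoriality

/-! ## §2 `Hom_E(A_K, A_μ)_ℚ = ℚ ⊗_ℤ Hom`: every element is `q ⊗ f` with ONE `f` -/

section RationalHom

variable {Hm : Type*} [AddCommGroup Hm]

/-- Common-denominator bookkeeping: `(q.num · n) · (1 ∕ (q.den · n)) = q` for `n ≠ 0`. [folklore] -/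
theorem num_mul_mul_one_div_den_mul (q : ℚ) {n : ℕ} (hn : n ≠ 0) :
    ((q.num * n : ℤ) : ℚ) * (1 / ((q.den * n : ℕ) : ℚ)) = q := by
  have hn' : (n : ℚ) ≠ 0 := by exact_mod_cast hn
  push_cast
  rw [mul_one_div, mul_div_mul_right _ _ hn', Rat.num_div_den]

/-- **Every element of `ℚ ⊗_ℤ Hom` is a pure tensor `q ⊗ f`** (clear denominators: `q ⊗ f + q' ⊗ f' = (1∕dd') ⊗ (q.num d' • f + q'.num d • f')`).
So a `ℚ`-linear combination of homomorphisms `A_K → A_μ` is a rational multiple of ONE homomorphism. [folklore] -/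
theorem exists_eq_rat_tmul (x : ℚ ⊗[ℤ] Hm) : ∃ (q : ℚ) (f : Hm), x = q ⊗ₜ f := by
  induction x using TensorProduct.induction_on with
  | zero => exact ⟨0, 0, by rw [TensorProduct.tmul_zero]⟩
  | tmul q f => exact ⟨q, f, rfl⟩
  | add x y hx hy =>
    obtain ⟨q, f, rfl⟩ := hx
    obtain ⟨q', f', rfl⟩ := hy
    refine ⟨1 / ((q.den * q'.den : ℕ) : ℚ), (q.num * q'.den : ℤ) • f + (q'.num * q.den : ℤ) • f', ?_⟩
    rw [TensorProduct.tmul_add, ← TensorProduct.smul_tmul, ← TensorProduct.smul_tmul, zsmul_eq_mul, zsmul_eq_mul,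
      num_mul_mul_one_div_den_mul q q'.den_nz, mul_comm q.den q'.den, num_mul_mul_one_div_den_mul q' q.den_nz]

end RationalHom

/-! ## §3 S4 packaged: the choice functions `qOf ∕ f_of` and the law `geom_eq`, in geometric normal form -/

section Packaged

variable {P X B A : SchemeOver ℂ} {Hm : Type*} [AddCommGroup Hm]

/-- **S4 at a pure tensor.**  If the level-`K` pull-back map `phiStar` of S2 evaluates on a pure tensor `q ⊗ f` as `q • (f_ℂ)^*_ℂ` (S2's
construction law; `bc f` = the complexified morphism `A_{K,ℂ} ⟶ A_{μ,ℂ}`), then restricting `alb^*_ℂ (phiStar (q ⊗ f) α)` to `P` along `incl`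
gives the complexified pull-back of `q • α` along the composite `incl ≫ alb ≫ bc f`. [cite: Liu2021, proof of Thm. 4.18 (l. 2247–2253); Lem. 2.4 (1)] -/
theorem geom_eq_tmul (incl : P ⟶ X) (alb : X ⟶ B) (bc : Hm → (B ⟶ A))
    (phiStar : ℚ ⊗[ℤ] Hm → (ℂ ⊗[ℚ] bettiCohomology A 1) →ₗ[ℂ] (ℂ ⊗[ℚ] bettiCohomology B 1))
    (h_tmul : ∀ (q : ℚ) (f : Hm) (c : ℂ ⊗[ℚ] bettiCohomology A 1), phiStar (q ⊗ₜ f) c = q • (pull (bc f) 1).baseChange ℂ c)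
    (α : ℂ ⊗[ℚ] bettiCohomology A 1) (q : ℚ) (f : Hm) :
    (pull incl 1).baseChange ℂ ((pull alb 1).baseChange ℂ (phiStar (q ⊗ₜ f) α)) =
      (pull (incl ≫ alb ≫ bc f) 1).baseChange ℂ (q • α) := by
  rw [h_tmul, geom_eq_core]

/-- **S4 PACKAGED (the fields `qOf`, `f_of`, `geom_eq` of `HcmPieces` v2, in geometric normal form).**  Under S2's construction law on pure
tensors there are choice functions `qOf : ℚ ⊗_ℤ Hom → ℚ` and `fOf : ℚ ⊗_ℤ Hom → Hom` with, for EVERY `φ`,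
`incl^*_ℂ (alb^*_ℂ (phiStar φ α)) = (incl ≫ alb ≫ bc (fOf φ))^*_ℂ (qOf φ • α)` — at the pin: `HcmPieces.qOf := qOf`,
`HcmPieces.f_of φ := incl ≫ alb ≫ bc (fOf φ) : P_Γ ⟶ (d_Liu (qOf φ)).A.X`, `HcmPieces.geom_eq := ‹this›` (with `resX`, `albK` unfolded to the
pull-backs along `incl`, `alb`, and `geomClass Γ d f = (pull f 1).baseChange ℂ d.α`). [cite: Liu2021, proof of Thm. 4.18 (l. 2247–2253); Lem. 2.4 (1); Def. 2.3] -/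
theorem exists_qOf_fOf (incl : P ⟶ X) (alb : X ⟶ B) (bc : Hm → (B ⟶ A))
    (phiStar : ℚ ⊗[ℤ] Hm → (ℂ ⊗[ℚ] bettiCohomology A 1) →ₗ[ℂ] (ℂ ⊗[ℚ] bettiCohomology B 1))
    (h_tmul : ∀ (q : ℚ) (f : Hm) (c : ℂ ⊗[ℚ] bettiCohomology A 1), phiStar (q ⊗ₜ f) c = q • (pull (bc f) 1).baseChange ℂ c)
    (α : ℂ ⊗[ℚ] bettiCohomology A 1) :
    ∃ (qOf : ℚ ⊗[ℤ] Hm → ℚ) (fOf : ℚ ⊗[ℤ] Hm → Hm), ∀ φ : ℚ ⊗[ℤ] Hm,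
      (pull incl 1).baseChange ℂ ((pull alb 1).baseChange ℂ (phiStar φ α)) =
        (pull (incl ≫ alb ≫ bc (fOf φ)) 1).baseChange ℂ (qOf φ • α) := by
  choose qOf fOf h using fun φ : ℚ ⊗[ℤ] Hm => exists_eq_rat_tmul φ
  refine ⟨qOf, fOf, fun φ => ?_⟩
  conv_lhs => rw [h φ]
  exact geom_eq_tmul incl alb bc phiStar h_tmul α (qOf φ) (fOf φ)

end Packaged

/-! ## §4 The same identities in the neighbours' shapes (S2: `phiStar φ = (ψ φ) ⊗ ℂ`; S1: the record's variety is a model `u : A ⟶ A'`) -/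

section Interfaces

variable {P X B A A' : SchemeOver ℂ} {Hm : Type*} [AddCommGroup Hm]

/-- `(q : ℂ) • v = q • v` on a `ℂ`-module that is also a `ℚ`-module (no compatibility of the two structures is needed:
Mathlib's `ratCast_smul_eq`). [folklore] -/
theorem ratCast_smul_eq_rat_smul {V : Type*} [AddCommGroup V] [Module ℂ V] [Module ℚ V] (q : ℚ) (v : V) :
    (q : ℂ) • v = q • v := by
  rw [ratCast_smul_eq ℂ ℚ q v, Rat.cast_id]

/-- **S4 in S2's shape.**  S2 (d2bridge-prove-2, `CorCM/D2Bridge/OmegaLevelwisePullback.lean`) builds the level-`K` map as the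
complexification `phiStar φ = (ψ φ).baseChange ℂ` of the `ℚ`-linear extension `ψ` of `f ↦ f_ℂ^*` to `ℚ ⊗_ℤ Hom`, so that
`ψ (q ⊗ f) = q • (bc f)^*` on RATIONAL classes; then `incl^*_ℂ (alb^*_ℂ ((ψ (q ⊗ f)) ⊗ ℂ) α) = (incl ≫ alb ≫ bc f)^*_ℂ (q • α)`.
[cite: Liu2021, proof of Thm. 4.18 (l. 2247–2253); Lem. 2.4 (1)] -/
theorem geom_eq_tmul_baseChange (incl : P ⟶ X) (alb : X ⟶ B) (bc : Hm → (B ⟶ A))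
    (ψ : ℚ ⊗[ℤ] Hm → (bettiCohomology A 1 →ₗ[ℚ] bettiCohomology B 1))
    (hψ : ∀ (q : ℚ) (f : Hm), ψ (q ⊗ₜ f) = q • pull (bc f) 1)
    (α : ℂ ⊗[ℚ] bettiCohomology A 1) (q : ℚ) (f : Hm) :
    (pull incl 1).baseChange ℂ ((pull alb 1).baseChange ℂ ((ψ (q ⊗ₜ f)).baseChange ℂ α)) =
      (pull (incl ≫ alb ≫ bc f) 1).baseChange ℂ (q • α) := by
  rw [hψ, LinearMap.baseChange_smul, LinearMap.smul_apply, geom_eq_core]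

/-- **S4 in S1's shape (d2bridge-prove-1, S1∕S4 interface).**  S1's record `d_Liu q` carries a MODEL `A'` of Liu's `A = A_μ ⊗_{E,ι₁} ℂ`
along `u : A ⟶ A'` (an isogeny onto a principal CM model) and the transported eigenvector `(q : ℂ) • α'`, where `α'` pulls back to `α₀`
under every morphism into `A`: `(f ≫ u)^*_ℂ α' = f^*_ℂ α₀`.  Then, for `j : P ⟶ B` (at the pin `P_Γ → A_{K,ℂ}`, or the Abel–Jacobi map
of `P_Γ` followed by the factor inclusion) and `g : B ⟶ A` (`f_ℂ`): `j^*_ℂ (q • g^*_ℂ α₀) = ((j ≫ g) ≫ u)^*_ℂ ((q : ℂ) • α')` — the S4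
law `geom_eq` with `f_of φ := (j ≫ g) ≫ u`. [cite: Liu2021, proof of Thm. 4.18 (l. 2247–2253); Lem. 2.4 (1)] -/
theorem geom_eq_core₂_transport (j : P ⟶ B) (g : B ⟶ A) (u : A ⟶ A')
    {α₀ : ℂ ⊗[ℚ] bettiCohomology A 1} {α' : ℂ ⊗[ℚ] bettiCohomology A' 1}
    (hu : ∀ (Y : SchemeOver ℂ) (f : Y ⟶ A), (pull (f ≫ u) 1).baseChange ℂ α' = (pull f 1).baseChange ℂ α₀) (q : ℚ) :
    (pull j 1).baseChange ℂ (q • (pull g 1).baseChange ℂ α₀) =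
      (pull ((j ≫ g) ≫ u) 1).baseChange ℂ ((q : ℂ) • α') := by
  rw [geom_eq_core₂]
  conv_rhs => rw [LinearMap.map_smul, hu, ratCast_smul_eq_rat_smul, rat_smul_baseChange_pull]

/-- **S4 in S1's shape, three maps**: `incl^*_ℂ (alb^*_ℂ (q • g^*_ℂ α₀)) = ((incl ≫ alb ≫ g) ≫ u)^*_ℂ ((q : ℂ) • α')`.
[cite: Liu2021, proof of Thm. 4.18 (l. 2247–2253); Lem. 2.4 (1)] -/
theorem geom_eq_core_transport (incl : P ⟶ X) (alb : X ⟶ B) (g : B ⟶ A) (u : A ⟶ A')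
    {α₀ : ℂ ⊗[ℚ] bettiCohomology A 1} {α' : ℂ ⊗[ℚ] bettiCohomology A' 1}
    (hu : ∀ (Y : SchemeOver ℂ) (f : Y ⟶ A), (pull (f ≫ u) 1).baseChange ℂ α' = (pull f 1).baseChange ℂ α₀) (q : ℚ) :
    (pull incl 1).baseChange ℂ ((pull alb 1).baseChange ℂ (q • (pull g 1).baseChange ℂ α₀)) =
      (pull ((incl ≫ alb ≫ g) ≫ u) 1).baseChange ℂ ((q : ℂ) • α') := by
  rw [geom_eq_core]
  conv_rhs => rw [LinearMap.map_smul, hu, ratCast_smul_eq_rat_smul, rat_smul_baseChange_pull]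

/-- **S4 PACKAGED in the neighbours' shapes at once**: S2's `phiStar φ = (ψ φ) ⊗ ℂ` with `ψ (q ⊗ f) = q • (bc f)^*`, S3's `resX ∘ albK` =
the complexified pull-backs along `incl`, `alb`, S1's model `u : A ⟶ A'` with transported eigenvector `α'`: there are choice functions
`qOf`, `fOf` with, for EVERY `φ ∈ ℚ ⊗_ℤ Hom`, `incl^*_ℂ (alb^*_ℂ ((ψ φ) ⊗ ℂ) α₀) = ((incl ≫ alb ≫ bc (fOf φ)) ≫ u)^*_ℂ ((qOf φ : ℂ) • α')`
— the fields `qOf`, `f_of φ := (incl ≫ alb ≫ bc (fOf φ)) ≫ u`, `geom_eq` of `HcmPieces` v2 at the pin, modulo unfolding.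
[cite: Liu2021, proof of Thm. 4.18 (l. 2247–2253); Lem. 2.4 (1); Def. 2.3] -/
theorem exists_qOf_fOf_transport (incl : P ⟶ X) (alb : X ⟶ B) (bc : Hm → (B ⟶ A)) (u : A ⟶ A')
    (ψ : ℚ ⊗[ℤ] Hm → (bettiCohomology A 1 →ₗ[ℚ] bettiCohomology B 1))
    (hψ : ∀ (q : ℚ) (f : Hm), ψ (q ⊗ₜ f) = q • pull (bc f) 1)
    {α₀ : ℂ ⊗[ℚ] bettiCohomology A 1} {α' : ℂ ⊗[ℚ] bettiCohomology A' 1}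
    (hu : ∀ (Y : SchemeOver ℂ) (f : Y ⟶ A), (pull (f ≫ u) 1).baseChange ℂ α' = (pull f 1).baseChange ℂ α₀) :
    ∃ (qOf : ℚ ⊗[ℤ] Hm → ℚ) (fOf : ℚ ⊗[ℤ] Hm → Hm), ∀ φ : ℚ ⊗[ℤ] Hm,
      (pull incl 1).baseChange ℂ ((pull alb 1).baseChange ℂ ((ψ φ).baseChange ℂ α₀)) =
        (pull ((incl ≫ alb ≫ bc (fOf φ)) ≫ u) 1).baseChange ℂ ((qOf φ : ℂ) • α') := by
  choose qOf fOf h using fun φ : ℚ ⊗[ℤ] Hm => exists_eq_rat_tmul φ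
  refine ⟨qOf, fOf, fun φ => ?_⟩
  conv_lhs => rw [h φ, hψ, LinearMap.baseChange_smul, LinearMap.smul_apply]
  exact geom_eq_core_transport incl alb (bc (fOf φ)) u hu (qOf φ)

end Interfaces

end Summit.HodgeConjecture.CorCM.D2Bridge

end
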